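import Literature.RepresentationTheory.FiniteGroups.MonomialRepresentation
import Literature.RepresentationTheory.FiniteGroups.InducedRecognition
import Literature.RepresentationTheory.Semisimple.Twist
import HarnessLib

/-!
# Monomial representations: conjugate data, and inflation followed by a twist is again induced

Topic `Literature/RepresentationTheory/FiniteGroups`.  Two complements on the monomial
representation `Ind_H^G θ` (`monomialRep H θ` on `ℂ^{G/H}`, `MonomialRepresentation.lean`;
Serre, *Linear Representations of Finite Groups*, §3.3, §7.1–7.2) used in the uniqueness of the
Langlands–Deligne local constants (Deligne, *Les constantes des équations fonctionnelles des
fonctions `L`*, Antwerp II (1973), proof of Thm. 4.1; Rohrlich, *Root numbers* (PCMI 2009),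
Lecture 4, Prop. 4.2 and (4.17)), where a representation of a Weil group `W` factoring through
a finite quotient `π : W → G` is written, in the Grothendieck group, as a combination of
`Ind_{H}^{G}(ξ)`'s and then twisted by an unramified character `χ` of `W`:

* `indClassFun_map_conj` — **conjugate data induce the same class function**:
  `Ind_{gHg⁻¹}^G (φ ∘ c_g⁻¹) = Ind_H^G φ` (Serre §7.2, Remark (3): `Ind f` only depends on the
  `G`-conjugacy class of `(H, f)`; immediate from the formula
  `Ind f (s) = |H|⁻¹ ∑_{t} f(t⁻¹ s t)`, substituting `t ↦ t g`).
* `nonempty_equiv_ind_of_comap_eq_range` — **inflation then twist is induced** (Rohrlich,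
  proof of Prop. 4.2: "`Ind_H^G ξ`, viewed as a representation of `W` and twisted by `ω`, is
  `ind_{M/K}(ξ ω)`"; the projection formula `Ind(θ) ⊗ χ ≅ Ind(θ ⊗ Res χ)` combined with
  `Infl ∘ Ind = Ind ∘ Infl`): for `π : W →* G`, `φ : W' →* W` with `φ(W') = π⁻¹(H)` and
  `χ : W →* ℂˣ`, the representation `w ↦ χ(w) · Ind_H^G θ (π w)` of `W` on `ℂ^{G/H}`
  (`Representation.twist` of `Literature/RepresentationTheory/Semisimple/Twist`) is isomorphic
  to Mathlib's `Representation.ind φ θ'` for any one-dimensional `θ'` of `W'` with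
  `θ'(w') = θ(π φ w') χ(φ w')` — by the recognition theorem
  `nonempty_equiv_ind` (`InducedRecognition.lean`): `e_H` is a `θ'`-eigenvector of `W'`, its
  `W`-translates span (`eq_top_of_forall_monomialRep_single_one_mem`, `π` surjective), and
  `dim ℂ^{G/H} = (G : H) = (W : π⁻¹ H)` (`Subgroup.index_comap_of_surjective`).

Everything is proved; no definitions.

## References

* J.-P. Serre, *Linear Representations of Finite Groups*, GTM 42 (1977), §3.3, §7.2 Remark (3).
  [SerreLinearRepresentations1977]
* D. Rohrlich, *Root numbers*, in: Arithmetic of `L`-functions, IAS/Park City Math. Ser. 18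
  (2011), Lecture 4, Prop. 4.2. [Rohrlich2011]
* P. Deligne, *Les constantes des équations fonctionnelles des fonctions `L`*, LNM 349 (1973),
  §4. [Deligne1973]
-/

noncomputable section

open scoped BigOperators

namespace Literature.RepresentationTheory.FiniteGroups

open Literature.RepresentationTheory.Semisimple

/-! ### Conjugate data -/

section Conj

variable {G : Type} [Group G]

/-- The extensions by zero of `φ` on `H` and of `φ'` on `gHg⁻¹`, `φ'(g h g⁻¹) = φ(h)`, are
conjugate functions on `G`: `φ'~(g x g⁻¹) = φ~(x)`. [folklore] -/
theorem extend_map_conj_apply (H : Subgroup G) (g : G) (φ : H → ℂ)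
    (φ' : H.map (MulAut.conj g).toMonoidHom → ℂ)
    (hφ' : ∀ (h : H) (h' : H.map (MulAut.conj g).toMonoidHom), (h' : G) = g * h * g⁻¹ → φ' h' = φ h)
    (x : G) :
    Function.extend (Subtype.val : H.map (MulAut.conj g).toMonoidHom → G) φ' 0 (g * x * g⁻¹) =
      Function.extend (Subtype.val : H → G) φ 0 x := by
  by_cases hx : x ∈ H
  · have hx' : g * x * g⁻¹ ∈ H.map (MulAut.conj g).toMonoidHom :=
      Subgroup.mem_map.mpr ⟨x, hx, rfl⟩
    rw [show g * x * g⁻¹ = ((⟨_, hx'⟩ : H.map (MulAut.conj g).toMonoidHom) : G) from rfl,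
      extend_subtypeVal_apply]
    have e : Function.extend (Subtype.val : H → G) φ 0 x = φ ⟨x, hx⟩ :=
      extend_subtypeVal_apply H φ ⟨x, hx⟩
    rw [e]
    exact hφ' ⟨x, hx⟩ ⟨_, hx'⟩ rfl
  · have hx' : g * x * g⁻¹ ∉ H.map (MulAut.conj g).toMonoidHom := by
      intro h
      obtain ⟨y, hy, hyx⟩ := Subgroup.mem_map.mp h
      have : y = x := by
        have e : (MulAut.conj g).toMonoidHom y = g * y * g⁻¹ := rfl
        rw [e] at hyx
        simpa using hyx
      exact hx (this ▸ hy)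
    rw [extend_subtypeVal_of_not_mem _ _ hx', extend_subtypeVal_of_not_mem _ _ hx]

variable [Fintype G]

/-- **Conjugate data induce the same class function**: `Ind_{gHg⁻¹}^G φ' = Ind_H^G φ` when
`φ'(g h g⁻¹) = φ(h)` (Serre §7.2, Remark (3); substitute `t ↦ t g` in
`Ind φ (s) = |H|⁻¹ ∑_t φ~(t⁻¹ s t)`). [cite: SerreLinearRepresentations1977, §7.2 Remark (3)] -/
theorem indClassFun_map_conj (H : Subgroup G) (g : G) (φ : H → ℂ)
    (φ' : H.map (MulAut.conj g).toMonoidHom → ℂ)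
    (hφ' : ∀ (h : H) (h' : H.map (MulAut.conj g).toMonoidHom), (h' : G) = g * h * g⁻¹ → φ' h' = φ h) :
    indClassFun (H.map (MulAut.conj g).toMonoidHom) φ' = indClassFun H φ := by
  funext s
  rw [indClassFun_apply, indClassFun_apply]
  have hcard : Nat.card (H.map (MulAut.conj g).toMonoidHom) = Nat.card H :=
    (Nat.card_congr (H.equivMapOfInjective (MulAut.conj g).toMonoidHom (MulAut.conj g).injective).toEquiv).symm
  rw [hcard]
  congr 1
  refine Fintype.sum_equiv (Equiv.mulRight g) _ _ fun t => ?_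
  simp only [Equiv.coe_mulRight]
  rw [← extend_map_conj_apply H g φ φ' hφ' ((t * g)⁻¹ * s * (t * g))]
  congr 1
  group

end Conj

/-! ### Inflation followed by a twist of a monomial representation is induced -/

section Inflation

variable {G : Type} [Group G] {W W' : Type*} [Group W] [Group W']

/-- **`(Ind_H^G θ ∘ π) ⊗ χ ≅ Ind_{W'}^{W} θ'`** (Rohrlich, PCMI 2009, Lecture 4, proof of
Prop. 4.2; Serre §3.3 Thm. 11 for the recognition).  Let `π : W →* G` be surjective with
`(G : H)` finite, `φ : W' →* W` with image `π⁻¹(H)`, `θ : H → ℂˣ`, `χ : W → ℂˣ`, and `θ'` a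
representation of `W'` on `ℂ` with `θ'(w') = θ(π φ w') χ(φ w')`.  Then the twist by `χ` of the
inflation to `W` of the monomial representation `Ind_H^G θ` (on `ℂ^{G/H}`) is isomorphic to the
induced representation `Representation.ind φ θ'` (Mathlib's tensor model): apply
`nonempty_equiv_ind` to `i : ℂ → ℂ^{G/H}`, `1 ↦ e_H`.
[cite: Rohrlich2011, Lecture 4 Prop. 4.2] -/
theorem nonempty_equiv_ind_of_comap_eq_range (π : W →* G) (hπ : Function.Surjective π)
    (H : Subgroup G) [H.FiniteIndex] (θ : H →* ℂˣ) (χ : W →* ℂˣ) (φ : W' →* W)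
    (hφ : φ.range = H.comap π) (θ' : Representation ℂ W' ℂ)
    (hθ' : ∀ (w' : W') (h : H), (h : G) = π (φ w') →
      θ' w' = (((θ h : ℂˣ) : ℂ) * ((χ (φ w') : ℂˣ) : ℂ)) • LinearMap.id) :
    Nonempty ((Representation.twist ((monomialRep H θ).comp π) χ).Equiv
      (Representation.ind φ θ')) := by
  classical
  haveI : Finite (G ⧸ H) := Subgroup.finite_quotient_of_finiteIndex
  haveI : φ.range.FiniteIndex := by
    rw [hφ]
    constructor
    rw [Subgroup.index_comap_of_surjective _ hπ]
    exact Subgroup.FiniteIndex.index_ne_zero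
  set σ : Representation ℂ W (G ⧸ H → ℂ) := Representation.twist ((monomialRep H θ).comp π) χ
    with hσ
  have hσapply : ∀ (w : W) (f : G ⧸ H → ℂ), σ w f = ((χ w : ℂˣ) : ℂ) • monomialRep H θ (π w) f :=
    fun w f => rfl
  set e₁ : G ⧸ H → ℂ := Pi.single ((1 : G) : G ⧸ H) 1 with he₁
  set i : ℂ →ₗ[ℂ] (G ⧸ H → ℂ) := LinearMap.toSpanSingleton ℂ (G ⧸ H → ℂ) e₁ with hi
  -- membership `π (φ w') ∈ H`
  have hmem : ∀ w' : W', π (φ w') ∈ H := fun w' => by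
    have : φ w' ∈ φ.range := ⟨w', rfl⟩
    rw [hφ] at this
    exact this
  refine nonempty_equiv_ind φ θ' σ i (fun w' => ?_) ?_ ?_
  · -- `i` intertwines `θ'` with `σ ∘ φ`
    refine LinearMap.ext fun c => ?_
    rw [LinearMap.comp_apply, LinearMap.comp_apply, hθ' w' ⟨_, hmem w'⟩ rfl, hi,
      LinearMap.toSpanSingleton_apply, LinearMap.toSpanSingleton_apply, LinearMap.smul_apply,
      LinearMap.id_apply, hσapply, map_smul, he₁,
      monomialRep_single_one_of_mem H θ ⟨_, hmem w'⟩]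
    simp only [smul_smul, smul_eq_mul]
    ring_nf
  · -- the translates of `e_H` span
    apply eq_top_of_forall_monomialRep_single_one_mem H θ
    intro y
    obtain ⟨w, rfl⟩ := hπ y
    have hle : (LinearMap.range i).map (σ w) ≤ ⨆ w : W, (LinearMap.range i).map (σ w) :=
      le_iSup (fun w : W => (LinearMap.range i).map (σ w)) w
    have hmem' : σ w e₁ ∈ (LinearMap.range i).map (σ w) :=
      Submodule.mem_map_of_mem ⟨1, by rw [hi, LinearMap.toSpanSingleton_apply, one_smul]⟩
    have h2 := Submodule.smul_mem _ (((χ w)⁻¹ : ℂˣ) : ℂ) (hle hmem')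
    rw [hσapply, smul_smul, Units.inv_mul, one_smul] at h2
    rw [he₁] at h2
    exact h2
  · -- dimensions
    rw [finrank_quotient_fun, Module.finrank_self, mul_one, hφ, Subgroup.index_comap_of_surjective _ hπ]

end Inflation

end Literature.RepresentationTheory.FiniteGroups
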